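import Mathlib
import Summits.ResolutionOfSingularities.ResolutionOfSingularities.Theorems.WildQuotientsWildQuotientResolutionFixedPointsGraded
import Literature.AlgebraicGeometry.Resolution.ResolutionOfComponents

/-!
# Conjugate cyclic actions have isomorphic quotients (chain w45c, rung LSB: change of coordinates)

(crux stmt-ResolutionOfSingularities-15640 `WildQuotients.WildQuotientResolution`, line `Sketch`;
rung LSB of `L/w45c/CHAIN.md` v3, the «conjugation-invariance lemma for `FixedPoints.subalgebra`»
asked by res-L1-w45c-plan-1 (22:02:37Z) for the corollary «every LINEAR `ℤ/2`-action on `𝔸ⁿ` in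
characteristic `2`»; [OURS · L1 W4.5c] — NOT a statement of any manuscript.)

For `k`-algebra automorphisms `σ, τ` of `B`, the map `b ↦ τ b` is a ring isomorphism from the
invariants of `⟨σ⟩` onto the invariants of the conjugate `⟨τ σ τ⁻¹⟩`
(`ringEquiv_fixedPoints_zpowers_conj_apply` records the formula), so the affine quotients
`Spec B^⟨σ⟩ ≅ Spec B^⟨τστ⁻¹⟩` are isomorphic and a resolution of one is a resolution of the other
(`hasResolution_fixedPoints_zpowers_conj`, via `Scheme.HasResolution.of_iso`): resolving a linear
action may be done in any coordinates.
-/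

-- single-problem summit: the doubled namespace component `ResolutionOfSingularities` is forced
set_option linter.dupNamespace false

noncomputable section

universe u

open CategoryTheory AlgebraicGeometry
open Literature.AlgebraicGeometry.Resolution

namespace Summit.ResolutionOfSingularities.ResolutionOfSingularities.Theorems.WildQuotientResolution.TameTransfer

variable {k B : Type u} [Field k] [CommRing B] [Algebra k B]

/-- `τ` maps `σ`-invariants to `τστ⁻¹`-invariants. [folklore] -/
theorem apply_mem_fixedPoints_zpowers_conj (σ τ : B ≃ₐ[k] B) {b : B}
    (hb : b ∈ FixedPoints.subalgebra k B (Subgroup.zpowers σ)) :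
    τ b ∈ FixedPoints.subalgebra k B (Subgroup.zpowers (τ * σ * τ⁻¹)) := by
  rw [mem_fixedPoints_zpowers_iff_apply_eq] at hb ⊢
  rw [AlgEquiv.mul_apply, AlgEquiv.mul_apply, ← AlgEquiv.mul_apply τ⁻¹ τ, inv_mul_cancel,
    AlgEquiv.one_apply, hb]

/-- **Conjugate cyclic actions have isomorphic rings of invariants**: `b ↦ τ b` is a ring
isomorphism `B^⟨σ⟩ ≃ B^⟨τστ⁻¹⟩`. [folklore] -/
theorem exists_ringEquiv_fixedPoints_zpowers_conj (σ τ : B ≃ₐ[k] B) :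
    ∃ e : FixedPoints.subalgebra k B (Subgroup.zpowers σ) ≃+*
        FixedPoints.subalgebra k B (Subgroup.zpowers (τ * σ * τ⁻¹)),
      ∀ b, (e b : B) = τ b := by
  have hinv : ∀ {b : B}, b ∈ FixedPoints.subalgebra k B (Subgroup.zpowers (τ * σ * τ⁻¹)) →
      τ⁻¹ b ∈ FixedPoints.subalgebra k B (Subgroup.zpowers σ) := by
    intro b hb
    have h := apply_mem_fixedPoints_zpowers_conj (τ * σ * τ⁻¹) τ⁻¹ hb
    have e : τ⁻¹ * (τ * σ * τ⁻¹) * τ⁻¹⁻¹ = σ := by group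
    rwa [e] at h
  refine ⟨{ toFun := fun b => ⟨τ b, apply_mem_fixedPoints_zpowers_conj σ τ b.2⟩
            invFun := fun b => ⟨τ⁻¹ b, hinv b.2⟩
            left_inv := fun b => Subtype.ext (by
              change τ⁻¹ (τ b) = b
              rw [← AlgEquiv.mul_apply, inv_mul_cancel, AlgEquiv.one_apply])
            right_inv := fun b => Subtype.ext (by
              change τ (τ⁻¹ b) = b
              rw [← AlgEquiv.mul_apply, mul_inv_cancel, AlgEquiv.one_apply])
            map_mul' := fun a b => Subtype.ext (by
              change τ (a * b) = τ a * τ b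
              exact map_mul τ _ _)
            map_add' := fun a b => Subtype.ext (by
              change τ (a + b) = τ a + τ b
              exact map_add τ _ _) }, fun b => rfl⟩

/-- **Resolutions of linear (or any) cyclic quotients may be computed in conjugate coordinates**:
if `Spec B^⟨σ⟩` has a resolution of singularities then so does `Spec B^⟨τστ⁻¹⟩`, for every
`k`-algebra automorphism `τ` of `B` (`Scheme.HasResolution.of_iso` along `Spec` of the ring
isomorphism `b ↦ τ b`). [folklore] -/
theorem hasResolution_fixedPoints_zpowers_conj (σ τ : B ≃ₐ[k] B)
    (h : Scheme.HasResolution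
      (Spec (CommRingCat.of (FixedPoints.subalgebra k B (Subgroup.zpowers σ))))) :
    Scheme.HasResolution
      (Spec (CommRingCat.of (FixedPoints.subalgebra k B (Subgroup.zpowers (τ * σ * τ⁻¹))))) := by
  obtain ⟨e, -⟩ := exists_ringEquiv_fixedPoints_zpowers_conj σ τ
  exact Scheme.HasResolution.of_iso (Scheme.Spec.mapIso e.symm.toCommRingCatIso.op).hom h

end Summit.ResolutionOfSingularities.ResolutionOfSingularities.Theorems.WildQuotientResolution.TameTransfer

end
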